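import Summits.CriticalPhenomena.PercolationContinuityZ3.Theorems.PercNearOneGluingNoHeavyLowerTailE3GroupSepCertCheck

/-!
# `NoHeavyLowerTail` (crux stmt-CriticalPhenomena-4575), E3GRP four-point classes: the three-copy certificate checker
# RESTRICTED TO A SUB-EDGE-SET (weights supported on chosen coordinates)

Support file (prover seat `prim-ineq-prove-1` gen 24; `--supports stmt-CriticalPhenomena-4575`).  Measure-free checker +
soundness; no `sorry`, no `native_decide`, nothing asserted about the crux.

`…E3GroupSepCertCheck` (`checkC n σ ts`, `checkC_sound`) certifies a signed cubic combination
`Φ(w) = Σ_j s_j μ(A_j) μ(B_j) μ(C_j)` of connectivity-event probabilities at EVERY weight vector on `K_n` by checking that all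
`4^{mE n}` three-copy fibre sums (tensor-Bernstein coefficients) are nonnegative — feasible for `n ≤ 5` (`4^10` digits) and out of
reach for `K₆` (`4^15`).  Many rows are, however, reduced by GLUING theorems (e.g. `FourPointSplit.sahiE3_fourPointSplit_nonneg_of
_terminalGluing` for the class `γ`) to weight vectors SUPPORTED on a small edge set `D ⊆ E(K_n)`.  For such weights only the fibre
sums of keys vanishing off `D` matter, and they are the fibre sums of the RESTRICTED corner tables `g ↦ T(ext g)` on the sub-cube of
dimension `|D|`:

* `extB ι g` — the corner of `K_n` extending `g : Fin m → Bool` by `false` off the coordinates `ι : Fin m → Fin (mE n)`;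
  `ML_restrict` — for `x` vanishing off `range ι`, `ML T x = ML (T ∘ extB ι) (x ∘ ι)`.
* `baseR n ι` — the reach tables of the `2^m` restricted corners; `checkR n ι σ ts` — the digit test of `…E3GroupSepCertCheck` in
  dimension `m` on the restricted tables (same Kronecker construction `krN4`, same AND-mask test).
* `checkR_sound` — **if `checkR n ι σ ts = true` (`ι` injective) then `0 ≤ cval w ts` for every `w : Sym2 (Fin n) → [0,1]` with
  `w (edgeE n i) = 0` for all coordinates `i ∉ range ι`** (diagonal values of `w` are irrelevant).
* `e3_of_checkE3R` — the `E₃ ≥ 0` instance (`E3Ineq`) for the Richards–Sahi terms `e3Terms`.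
The cost is `4^m` digits instead of `4^{mE n}`; the evaluations (COMPUTATIONAL, `native_decide`) live in the files that use them.
-/

namespace Summit.CriticalPhenomena.PercolationContinuityZ3.Theorems.E3GroupSepCert

open Finset MeasureTheory OneCutCert CovTransferCert
open scoped BigOperators
open Literature.Probability.Percolation Literature.Probability.LatticeModels
open Summit.CriticalPhenomena.PercolationContinuityZ3.Theorems.AdditiveGluing.Negative.Cert (reachTable)

variable {n : ℕ}

/-! ## Corners of a sub-cube -/

/-- Extension by `false`: the corner of the big cube that agrees with `g` on the coordinates `ι t` and is `false` elsewhere.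
[this work] -/
def extB {M m : ℕ} (ι : Fin m → Fin M) (g : Fin m → Bool) : Fin M → Bool :=
  fun i => decide (∃ t : Fin m, ι t = i ∧ g t = true)

/-- `extB ι g (ι t) = g t` for injective `ι`. [this work] -/
theorem extB_apply {M m : ℕ} {ι : Fin m → Fin M} (hι : Function.Injective ι) (g : Fin m → Bool) (t : Fin m) :
    extB ι g (ι t) = g t := by
  unfold extB
  rw [Bool.eq_iff_iff, decide_eq_true_iff]
  constructor
  · rintro ⟨t', ht', hg⟩
    rw [hι ht'] at hg
    exact hg
  · intro hg
    exact ⟨t, rfl, hg⟩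

/-- `extB ι g` vanishes off the range of `ι`. [this work] -/
theorem extB_of_not_mem {M m : ℕ} (ι : Fin m → Fin M) (g : Fin m → Bool) {i : Fin M} (hi : i ∉ Set.range ι) :
    extB ι g i = false := by
  unfold extB
  rw [decide_eq_false_iff_not]
  rintro ⟨t, ht, -⟩
  exact hi ⟨t, ht⟩

/-- `extB ι` is injective for injective `ι`. [this work] -/
theorem extB_injective {M m : ℕ} {ι : Fin m → Fin M} (hι : Function.Injective ι) : Function.Injective (extB ι) := by
  intro g g' h
  funext t
  rw [← extB_apply hι g t, ← extB_apply hι g' t, h]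

/-- A corner vanishing off the range of `ι` is an extension. [this work] -/
theorem extB_comp_eq {M m : ℕ} {ι : Fin m → Fin M} (hι : Function.Injective ι) (G : Fin M → Bool)
    (hG : ∀ i, i ∉ Set.range ι → G i = false) : extB ι (fun t => G (ι t)) = G := by
  funext i
  by_cases hi : i ∈ Set.range ι
  · obtain ⟨t, rfl⟩ := hi
    rw [extB_apply hι]
  · rw [extB_of_not_mem ι _ hi, hG i hi]

/-- The corner with bits those of `j`. [this work] -/
def decB (m : ℕ) (j : ℕ) : Fin m → Bool := fun t => j.testBit t.val

/-- `decB` inverts `enc2`. [this work] -/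
theorem decB_enc2 {m : ℕ} (g : Fin m → Bool) : decB m (enc2 g) = g :=
  funext fun t => testBit_enc2 g t

/-! ## Multilinear polynomials at points vanishing off the chosen coordinates -/

/-- The corner weight of an extended corner only sees the chosen coordinates. [this work] -/
theorem mono_extB {M m : ℕ} {ι : Fin m → Fin M} (hι : Function.Injective ι) (x : Fin M → ℝ)
    (hx : ∀ i, i ∉ Set.range ι → x i = 0) (g : Fin m → Bool) :
    mono x (extB ι g) = mono (x ∘ ι) g := by
  classical
  unfold mono
  rw [← Finset.prod_mul_prod_compl (Finset.univ.image ι)]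
  have h1 : ∏ i ∈ Finset.univ.image ι, (if extB ι g i = true then x i else 1 - x i) =
      ∏ t, (if g t = true then (x ∘ ι) t else 1 - (x ∘ ι) t) := by
    rw [Finset.prod_image fun t _ t' _ h => hι h]
    refine Finset.prod_congr rfl fun t _ => ?_
    rw [extB_apply hι]
    rfl
  have h2 : ∏ i ∈ (Finset.univ.image ι)ᶜ, (if extB ι g i = true then x i else 1 - x i) = 1 := by
    refine Finset.prod_eq_one fun i hi => ?_
    have hi' : i ∉ Set.range ι := by
      intro hr
      obtain ⟨t, rfl⟩ := hr
      rw [Finset.mem_compl] at hi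
      exact hi (Finset.mem_image_of_mem ι (Finset.mem_univ t))
    rw [extB_of_not_mem ι g hi', hx i hi']
    simp
  rw [h1, h2, mul_one]

/-- **Restriction of a multilinear polynomial**: at a point vanishing off `range ι`, `ML T x` is the multilinear polynomial of the
restricted table `T ∘ extB ι` at the restricted point. [this work] -/
theorem ML_restrict {M m : ℕ} {ι : Fin m → Fin M} (hι : Function.Injective ι) (T : (Fin M → Bool) → ℝ) (x : Fin M → ℝ)
    (hx : ∀ i, i ∉ Set.range ι → x i = 0) :
    ML T x = ML (fun g => T (extB ι g)) (x ∘ ι) := by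
  classical
  unfold ML
  have hvan : ∀ G ∈ (Finset.univ : Finset (Fin M → Bool)), G ∉ Finset.univ.image (extB ι) → T G * mono x G = 0 := by
    intro G _ hG
    -- some coordinate off `range ι` is `true`, and `x` vanishes there
    have hex : ∃ i, i ∉ Set.range ι ∧ G i = true := by
      by_contra hne
      apply hG
      refine Finset.mem_image.2 ⟨fun t => G (ι t), Finset.mem_univ _, extB_comp_eq hι G fun i hi => ?_⟩
      cases hGi : G i
      · rfl
      · exact absurd ⟨i, hi, hGi⟩ hne
    obtain ⟨i, hi, hGi⟩ := hex
    have hm : mono x G = 0 := by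
      unfold mono
      exact Finset.prod_eq_zero (Finset.mem_univ i) (by rw [if_pos hGi, hx i hi])
    rw [hm, mul_zero]
  rw [← Finset.sum_subset (Finset.subset_univ (Finset.univ.image (extB ι))) hvan,
    Finset.sum_image fun g _ g' _ h => extB_injective hι h]
  exact Finset.sum_congr rfl fun g _ => by rw [mono_extB hι x hx g]

/-! ## The restricted checker -/

/-- Reach tables of the `2^m` restricted corners (computed once, shared by all tables). [this work] -/
def baseR (n : ℕ) {m : ℕ} (ι : Fin m → Fin (mE n)) : List (List ℕ) :=
  (List.range (2 ^ m)).map fun j => reachTable n (cfg (extB ι (decB m j)))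

/-- The certificate number in dimension `m` from reach tables `base`. [this work] -/
def zCm (base : List (List ℕ)) (m σ : ℕ) (ts : List (CTerm n)) : ℤ :=
  let K : (CRel n → Bool) → ℤ := fun P => (krN4 σ m (evTabRT base P) : ℤ)
  (ts.map fun t => t.1 * (K t.2.1 * K t.2.2.1 * K t.2.2.2)).sum

/-- The digit test in dimension `m`: coefficient bound `sabs · 8^m < 2^(σ-1)` and the AND-mask test on `Z + offT`. [this work] -/
def checkCm (base : List (List ℕ)) (m σ : ℕ) (ts : List (CTerm n)) : Bool :=
  let Z := zCm base m σ ts + offT σ m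
  decide (0 < σ) && decide (sabs ts * 8 ^ m < 2 ^ (σ - 1)) && decide (0 ≤ Z) &&
    decide ((Z.toNat &&& (offT σ m).toNat) = (offT σ m).toNat)

/-- **The restricted three-copy check** along the coordinates `ι`. [this work] -/
def checkR (n : ℕ) {m : ℕ} (ι : Fin m → Fin (mE n)) (σ : ℕ) (ts : List (CTerm n)) : Bool :=
  checkCm (baseR n ι) m σ ts

/-- The restricted integer corner table of a connectivity event. [this work] -/
def tabR {m : ℕ} (ι : Fin m → Fin (mE n)) (P : CRel n → Bool) : (Fin m → Bool) → ℤ := fun g => tabT n P (extB ι g)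

/-- `|tabR| ≤ 1`. [this work] -/
theorem abs_tabR_le {m : ℕ} (ι : Fin m → Fin (mE n)) (P : CRel n → Bool) (g : Fin m → Bool) : |tabR ι P g| ≤ 1 :=
  abs_tabT_le P _

/-- Length of the restricted list table. [this work] -/
theorem length_evTabRT_baseR {m : ℕ} (ι : Fin m → Fin (mE n)) (P : CRel n → Bool) :
    (evTabRT (baseR n ι) P).length = 2 ^ m := by
  simp [evTabRT, baseR]

/-- The restricted list table represents `tabR`. [this work] -/
theorem tabOf_evTabRT_baseR {m : ℕ} (ι : Fin m → Fin (mE n)) (P : CRel n → Bool) (g : Fin m → Bool) :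
    tabOf ((evTabRT (baseR n ι) P).map ((↑) : ℕ → ℤ)) g = tabR ι P g := by
  unfold tabR tabOf evTabRT baseR
  rw [tabT_apply, List.getD_eq_getElem?_getD, List.map_map, List.map_map, List.getElem?_map,
    List.getElem?_range (enc2_lt g)]
  simp only [Option.map_some, Option.getD_some, Function.comp, decB_enc2]
  unfold connB
  split_ifs <;> simp

/-- The Kronecker number of a restricted list table. [this work] -/
theorem krN4_baseR_eq {m : ℕ} (ι : Fin m → Fin (mE n)) (σ : ℕ) (P : CRel n → Bool) :
    (krN4 σ m (evTabRT (baseR n ι) P) : ℤ) = KR4 (2 ^ σ) (tabR ι P) := by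
  rw [krN4_eq σ m _ (length_evTabRT_baseR ι P)]
  congr 1
  funext g
  exact tabOf_evTabRT_baseR ι P g

set_option maxHeartbeats 800000 in
/-- **Soundness of `checkR`**: for `ι` injective, if the restricted check passes then the cubic form is nonnegative at every weight
vector vanishing on the coordinates off `range ι` (diagonal values are irrelevant). [this work] -/
theorem checkR_sound {m : ℕ} {ι : Fin m → Fin (mE n)} (hι : Function.Injective ι) (σ : ℕ) (ts : List (CTerm n))
    (h : checkR n ι σ ts = true) (w : Sym2 (Fin n) → unitInterval)
    (hw : ∀ i : Fin (mE n), i ∉ Set.range ι → w (edgeE n i) = 0) : 0 ≤ cval w ts := by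
  unfold checkR checkCm at h
  simp only [Bool.and_eq_true, decide_eq_true_eq] at h
  obtain ⟨⟨⟨hσ, hbnd⟩, hZ⟩, hland⟩ := h
  -- the Fin-indexed data (restricted tables)
  let s : Fin ts.length → ℤ := fun j => (ts[(j : ℕ)]).1
  let X : Fin ts.length → (Fin m → Bool) → ℤ := fun j => tabR ι (ts[(j : ℕ)]).2.1
  let Y : Fin ts.length → (Fin m → Bool) → ℤ := fun j => tabR ι (ts[(j : ℕ)]).2.2.1
  let Z3 : Fin ts.length → (Fin m → Bool) → ℤ := fun j => tabR ι (ts[(j : ℕ)]).2.2.2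
  have hoff : offT σ m = (maskN σ (4 ^ m) : ℤ) := by
    unfold offT
    rw [off_eq σ (4 ^ m) hσ, maskN_eq_sum σ hσ, Finset.mul_sum]
  rw [hoff] at hZ hland
  rw [Int.toNat_natCast] at hland
  have hZeq : zCm (baseR n ι) m σ ts = cubicZ (2 ^ σ) s X Y Z3 := by
    unfold zCm cubicZ
    dsimp only
    rw [← sum_fin_eq_sum_map ts]
    refine Finset.sum_congr rfl fun j _ => ?_
    rw [krN4_baseR_eq, krN4_baseR_eq, krN4_baseR_eq]
  have hB : CoefBound3 s X Y Z3 (2 ^ (σ - 1)) := by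
    intro k
    have h8 : ∀ j, |s j * pcoef3 (X j) (Y j) (Z3 j) k| ≤ |s j| * 8 ^ m := by
      intro j
      rw [abs_mul]
      exact mul_le_mul_of_nonneg_left
        (abs_pcoef3_le _ _ _ (abs_tabR_le ι _) (abs_tabR_le ι _) (abs_tabR_le ι _) k) (abs_nonneg _)
    have hsum : |cubicCoef s X Y Z3 k| ≤ (sabs ts : ℤ) * 8 ^ m := by
      unfold cubicCoef
      rw [sabs_eq, Finset.sum_mul]
      exact (Finset.abs_sum_le_sum_abs _ _).trans (Finset.sum_le_sum fun j _ => h8 j)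
    have hpow : (sabs ts : ℤ) * 8 ^ m < (2 : ℕ) ^ (σ - 1) := by exact_mod_cast hbnd
    exact lt_of_le_of_lt hsum hpow
  set N : ℕ := (zCm (baseR n ι) m σ ts + maskN σ (4 ^ m)).toNat with hN
  have hNZ : (N : ℤ) = cubicZ (2 ^ σ) s X Y Z3 + ∑ j : Fin (4 ^ m), (2 : ℤ) ^ (σ - 1) * (2 ^ σ) ^ (j : ℕ) := by
    rw [hN, Int.toNat_of_nonneg hZ, hZeq, maskN_eq_sum σ hσ, Fin.sum_univ_eq_sum_range
      (fun j => (2 : ℤ) ^ (σ - 1) * (2 ^ σ) ^ j) (4 ^ m)]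
  have hdig : ∀ j : ℕ, j < 4 ^ m → 2 ^ (σ - 1) ≤ digit (2 ^ σ) N j := digit_ge_of_land σ hσ (4 ^ m) N hland
  have hk : ∀ k, 0 ≤ cubicCoef s X Y Z3 k := cubicCoef_nonneg_of_digit_ge hσ hB N hNZ hdig
  -- the restricted point of the cube
  have hx : ∀ i : Fin (mE n), i ∉ Set.range ι → xOf w i = 0 := by
    intro i hi
    unfold xOf
    rw [hw i hi]
    rfl
  have hcube : InCube (xOf w ∘ ι) := fun t => inCube_xOf w (ι t)
  have hF : 0 ≤ cubicForm s X Y Z3 (xOf w ∘ ι) := cubicForm_nonneg hk hcube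
  unfold cubicForm at hF
  have hML : ∀ P : CRel n → Bool, ML (fun g => (tabR ι P g : ℝ)) (xOf w ∘ ι) = pr w P := by
    intro P
    unfold pr tabR
    rw [real_connEvent_eq_ML, ML_restrict hι _ _ hx]
  have hval : (∑ j : Fin ts.length, (s j : ℝ) * (ML (fun g => (X j g : ℝ)) (xOf w ∘ ι) * ML (fun g => (Y j g : ℝ)) (xOf w ∘ ι) *
      ML (fun g => (Z3 j g : ℝ)) (xOf w ∘ ι))) = cval w ts := by
    unfold cval
    rw [← sum_fin_eq_sum_map ts]
    refine Finset.sum_congr rfl fun j _ => ?_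
    simp only [s, X, Y, Z3, hML]
    ring
  rw [hval] at hF
  exact hF

/-! ## The Richards–Sahi instance -/

/-- The restricted check of the `E₃` terms. [this work] -/
def checkE3R (n : ℕ) {m : ℕ} (ι : Fin m → Fin (mE n)) (σ : ℕ) (A B C : CRel n → Bool) : Bool :=
  checkR n ι σ (e3Terms A B C)

/-- **`E₃ ≥ 0` from the restricted check**, at every weight vector supported on the chosen coordinates. [this work] -/
theorem e3_of_checkE3R {m : ℕ} {ι : Fin m → Fin (mE n)} (hι : Function.Injective ι) {σ : ℕ} {A B C : CRel n → Bool}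
    (h : checkE3R n ι σ A B C = true) (w : Sym2 (Fin n) → unitInterval)
    (hw : ∀ i : Fin (mE n), i ∉ Set.range ι → w (edgeE n i) = 0) : E3Ineq w A B C := by
  have hv := checkR_sound hι σ _ h w hw
  unfold cval e3Terms at hv
  simp only [List.map_cons, List.map_nil, List.sum_cons, List.sum_nil, pr_pTrue] at hv
  unfold pr at hv
  simp only [connEvent_pAnd] at hv
  rw [← Set.inter_assoc] at hv
  unfold E3Ineq
  push_cast at hv
  linarith

end Summit.CriticalPhenomena.PercolationContinuityZ3.Theorems.E3GroupSepCert
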